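import Literature.ModelTheory.ExponentialFields.CodeNewtonSentences
import Literature.ModelTheory.ExponentialFields.LastRootConjectureOfDecidable
import Literature.ModelTheory.ProofTheory.ExistentialCodes
import HarnessLib

/-!
# The scheme of code Newton sentences is recursively enumerable

Family `periods` (periods.S27), topic `Literature/ModelTheory/ExponentialFields`: leaf (B4) of the
decomposition of the conditional half of Macintyre–Wilkie's theorem
(`Literature.ModelTheory.ExponentialFields.macintyreWilkie_existential_of_schanuelProperty`; assembly in
`MacintyreWilkieConditionalHalf.lean`).

The recursive subtheory used there is `OEF ∪ NewtonScheme`, where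
`ExpPolyCode.newtonScheme = {codeNewtonSentence n F | n, F}` (`CodeNewtonSentences.lean`).  For
Craig's trick (`MacintyreWilkieREAxioms.lean`) the scheme must be an **r.e. set of sentences**
(`Theory.IsREAxioms`: the set of Gödel numbers is r.e.).  This file proves it, by the method of
`LastRootConjectureOfDecidable.lean` (arithmetisation of the syntax of the bounding sentences):
the Gödel letters of `codeNewtonSentence n F` are computed by a primitive recursive function of
`(n, F)` (`ExpPolyCode.codeNewtonL`, `godelNumber_codeNewtonSentence`, `primrec_codeNewtonL`), so
the scheme is the range of a computable function, hence r.e. (`REPred.range_of_computable`,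
**`ExpPolyCode.newtonScheme_isREAxioms`**).

New syntactic ingredients (beyond those of `LastRootConjectureOfDecidable.lean`): the letters of
a relabelled term (`termLetters_relabel`: variable letters `4 i + 2 ↦ 4 f(i) + 2`), of the
structural majorant `NewtonExp.majTerm` (`termLetters_majTerm`: drop the letters of `-`, replace
variable letters by the letters of `w`), of the code derivatives `ExpPolyCode.pdCode`
(`primrec_pdCode`), and of the blocks `∃^n` (`exNL`).

## References

* H. B. Enderton, *A Mathematical Introduction to Logic*, 2nd ed. (2001), §3.4 (arithmetization
  of syntax).
* A. Macintyre, A. J. Wilkie, *On the decidability of the real exponential field* (1996), §5.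
-/

noncomputable section

namespace Literature.ModelTheory.ExponentialFields

namespace ExpPolyCode

open FirstOrder FirstOrder.Language Encodable ProofTheory.PreFOL RealExpModel NewtonExp

/-! ### Letters: distinctness and residues of the symbol letters -/

section SymbolLetters

/-- The symbol letters are odd. [folklore] -/
theorem lNeg_mod_two : lNeg % 2 = 1 := by unfold lNeg; omega
/-- `lAdd ≠ lNeg` (different arities). [folklore] -/
theorem lAdd_ne_lNeg : lAdd ≠ lNeg := by
  intro h
  have := Nat.succ_injective h
  have := encode_injective (Nat.eq_of_mul_eq_mul_left (by norm_num) this)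
  simp at this
/-- `lMul ≠ lNeg` (different arities). [folklore] -/
theorem lMul_ne_lNeg : lMul ≠ lNeg := by
  intro h
  have := Nat.succ_injective h
  have := encode_injective (Nat.eq_of_mul_eq_mul_left (by norm_num) this)
  simp at this
/-- `lZero ≠ lNeg` (different arities). [folklore] -/
theorem lZero_ne_lNeg : lZero ≠ lNeg := by
  intro h
  have := Nat.succ_injective h
  have := encode_injective (Nat.eq_of_mul_eq_mul_left (by norm_num) this)
  simp at this
/-- `lOne ≠ lNeg` (different arities). [folklore] -/
theorem lOne_ne_lNeg : lOne ≠ lNeg := by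
  intro h
  have := Nat.succ_injective h
  have := encode_injective (Nat.eq_of_mul_eq_mul_left (by norm_num) this)
  simp at this
/-- `lExp ≠ lNeg` (different symbols of arity one). [folklore] -/
theorem lExp_ne_lNeg : lExp ≠ lNeg := by
  intro h
  have := Nat.succ_injective h
  have := encode_injective (Nat.eq_of_mul_eq_mul_left (by norm_num) this)
  simp at this

/-- A symbol letter `2 e + 1` is not a variable letter (`≡ 2 mod 4`). [folklore] -/
theorem symbolLetter_mod_four (e : ℕ) : (2 * e + 1) % 4 ≠ 2 := by omega

end SymbolLetters

/-! ### Letters of relabelled terms -/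

section Relabel

variable {n d : ℕ}

/-- The action on letters of relabelling the variables along `i ↦ f i`: variable letters
`4 i + 2 ↦ 4 f(i) + 2`, other letters fixed. [folklore] -/
def relabL (f : ℕ → ℕ) (l : ℕ) : ℕ := if l % 4 = 2 then 4 * f (l / 4) + 2 else l

/-- `relabL id` is the identity. [folklore] -/
theorem relabL_id (l : ℕ) : relabL _root_.id l = l := by
  unfold relabL; split_ifs with h <;> simp; omega

/-- **Letters of a relabelled term**: relabelling the (non-parameter) variables along
`g : Fin n → Fin d` with `(g i).val = f i` maps the letters by `relabL f`. [folklore] -/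
theorem termLetters_relabel (g : Fin n → Fin d) (f : ℕ → ℕ) (hg : ∀ i, (g i).val = f i.val) :
    ∀ t : Language.orderedExpRing.Term (Empty ⊕ Fin n),
      termLetters (t.relabel (Sum.map _root_.id g)) = (termLetters t).map (relabL f)
  | var (Sum.inl e) => e.elim
  | var (Sum.inr i) => by
    rw [Term.relabel, Sum.map_inr, termLetters_var, termLetters_var, List.map_singleton, hg i]
    simp only [relabL]
    rw [if_pos (by omega), show (4 * i.val + 2) / 4 = i.val by omega]
  | func F ts => by
    rw [Term.relabel, termLetters_func, termLetters_func, List.map_cons]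
    congr 1
    · simp only [relabL]
      rw [if_neg (symbolLetter_mod_four _)]
    · rw [List.map_flatten, List.map_ofFn]
      exact congrArg List.flatten (congrArg List.ofFn (funext fun i => termLetters_relabel g f hg (ts i)))

end Relabel

/-! ### Letters of the structural majorant -/

section Majorant

variable {n d : ℕ}

/-- The action on letters of `NewtonExp.majTerm w`: drop the letters of `-`, replace each variable
letter by the letters `wL` of `w`, keep the other letters. [folklore] -/
def majL (wL : List ℕ) (tL : List ℕ) : List ℕ :=
  tL.flatMap fun l => if l = lNeg then [] else if l % 4 = 2 then wL else [l]

/-- `majL` on a cons. [folklore] -/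
theorem majL_cons (wL : List ℕ) (l : ℕ) (tL : List ℕ) :
    majL wL (l :: tL) = (if l = lNeg then [] else if l % 4 = 2 then wL else [l]) ++ majL wL tL := by
  simp [majL]

/-- `majL` over an append. [folklore] -/
theorem majL_append (wL tL sL : List ℕ) : majL wL (tL ++ sL) = majL wL tL ++ majL wL sL := by
  simp [majL]

/-- **Letters of the structural majorant** `NewtonExp.majTerm w t`. [folklore] -/
theorem termLetters_majTerm (w : Language.orderedExpRing.Term (Empty ⊕ Fin d)) :
    ∀ t : Language.orderedExpRing.Term (Empty ⊕ Fin n),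
      termLetters (majTerm w t) = majL (termLetters w) (termLetters t)
  | var (Sum.inl e) => e.elim
  | var (Sum.inr i) => by
    rw [majTerm, termLetters_var, majL_cons]
    have h1 : 4 * i.val + 2 ≠ lNeg := fun h => by have := lNeg_mod_two; omega
    rw [if_neg h1, if_pos (by omega)]
    simp [majL]
  | func expRingFunc.add ts => by
    rw [majTerm, termLetters_add', termLetters_func, majL_cons]
    simp only [show 2 * encode (⟨2, expRingFunc.add⟩ : Σ i, Language.orderedExpRing.Functions i) + 1 = lAdd
      from rfl, if_neg lAdd_ne_lNeg, List.ofFn_succ, List.ofFn_zero, List.flatten_cons, List.flatten_nil,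
      List.append_nil, majL_append, termLetters_majTerm w (ts 0), termLetters_majTerm w (ts 1),
      Fin.succ_zero_eq_one, addL]
    rw [if_neg (by unfold lAdd; omega), List.singleton_append]
  | func expRingFunc.mul ts => by
    rw [majTerm, termLetters_mul', termLetters_func, majL_cons]
    simp only [show 2 * encode (⟨2, expRingFunc.mul⟩ : Σ i, Language.orderedExpRing.Functions i) + 1 = lMul
      from rfl, if_neg lMul_ne_lNeg, List.ofFn_succ, List.ofFn_zero, List.flatten_cons, List.flatten_nil,
      List.append_nil, majL_append, termLetters_majTerm w (ts 0), termLetters_majTerm w (ts 1),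
      Fin.succ_zero_eq_one, mulL]
    rw [if_neg (by unfold lMul; omega), List.singleton_append]
  | func expRingFunc.neg ts => by
    rw [majTerm, termLetters_func, majL_cons]
    simp only [show 2 * encode (⟨1, expRingFunc.neg⟩ : Σ i, Language.orderedExpRing.Functions i) + 1 = lNeg
      from rfl, if_true, List.nil_append, List.ofFn_succ, List.ofFn_zero, List.flatten_cons,
      List.flatten_nil, List.append_nil]
    exact termLetters_majTerm w (ts 0)
  | func expRingFunc.zero ts => by
    rw [majTerm, termLetters_zero', termLetters_func, majL_cons]
    simp only [show 2 * encode (⟨0, expRingFunc.zero⟩ : Σ i, Language.orderedExpRing.Functions i) + 1 = lZero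
      from rfl, if_neg lZero_ne_lNeg, List.ofFn_zero, List.flatten_nil, majL, List.flatMap_nil, List.append_nil]
    rw [if_neg (by unfold lZero; omega)]
  | func expRingFunc.one ts => by
    rw [majTerm, termLetters_one', termLetters_func, majL_cons]
    simp only [show 2 * encode (⟨0, expRingFunc.one⟩ : Σ i, Language.orderedExpRing.Functions i) + 1 = lOne
      from rfl, if_neg lOne_ne_lNeg, List.ofFn_zero, List.flatten_nil, majL, List.flatMap_nil, List.append_nil]
    rw [if_neg (by unfold lOne; omega)]
  | func expRingFunc.exp ts => by
    rw [majTerm, termLetters_exp', termLetters_func, majL_cons]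
    simp only [show 2 * encode (⟨1, expRingFunc.exp⟩ : Σ i, Language.orderedExpRing.Functions i) + 1 = lExp
      from rfl, if_neg lExp_ne_lNeg, List.ofFn_succ, List.ofFn_zero, List.flatten_cons, List.flatten_nil,
      List.append_nil, termLetters_majTerm w (ts 0)]
    rw [if_neg (by unfold lExp; omega), List.singleton_append]

end Majorant

/-! ### Letters of the code Newton sentence -/

section NewtonLetters

variable (n : ℕ) (F : List ExpPolyCode)

/-- letters of `β` (index `n + n·n`) [folklore] -/
def βL : List ℕ := [4 * (n + n * n) + 2]
/-- letters of `δ` (index `n + n·n + 1`) [folklore] -/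
def δL : List ℕ := [4 * (n + n * n + 1) + 2]
/-- letters of `ν` (index `n + n·n + 2`) [folklore] -/
def νL : List ℕ := [4 * (n + n * n + 2) + 2]

/-- letters of `F_i(q̄)` [folklore] -/
def FqL (i : ℕ) : List ℕ := evalL n xvL (F.getD i [])
/-- letters of the Jacobian-entry term `G j k (q̄) = ∂ₖ F_j (q̄)` [folklore] -/
def GqL (j k : ℕ) : List ℕ := evalL n xvL (pdCode n k (F.getD j []))
/-- letters of the second-derivative term `H i j k = ∂ₖ ∂ⱼ F_i` [folklore] -/
def HL (i j k : ℕ) : List ℕ := evalL n xvL (pdCode n k (pdCode n j (F.getD i [])))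
/-- letters of the Lipschitz term `Lip_H(ν)` [folklore] -/
def lipL : List ℕ :=
  sumL ((List.range n).map fun i => sumL ((List.range n).map fun j =>
    sumL ((List.range n).map fun k => majL (νL n) (HL n F i j k))))
/-- letters of `|t| ≤ s` at depth `d` [folklore] -/
def absLeL (d : ℕ) (tL sL : List ℕ) : List ℕ := infL d (leL d (lNeg :: sL) tL) (leL d tL sL)
/-- letters of the hypothesis `Hyp(q̄, B, β, δ, ν)` [folklore] -/
def hypL : List ℕ :=
  andLL (NewtonExp.dep n) [
    leL (NewtonExp.dep n) [lZero] (βL n),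
    leL (NewtonExp.dep n) [lZero] (δL n),
    leL (NewtonExp.dep n) [lZero] (νL n),
    andLL (NewtonExp.dep n) ((List.range n).map fun i => andLL (NewtonExp.dep n) ((List.range n).map fun k =>
      eqL (NewtonExp.dep n) (sumL ((List.range n).map fun j => mulL (bvL n i j) (GqL n F j k)))
        (if i = k then [lOne] else [lZero]))),
    andLL (NewtonExp.dep n) ((List.range n).map fun i => andLL (NewtonExp.dep n) ((List.range n).map fun j =>
      absLeL (NewtonExp.dep n) (bvL n i j) (βL n))),
    andLL (NewtonExp.dep n) ((List.range n).map fun i => absLeL (NewtonExp.dep n) (FqL n F i) (δL n)),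
    andLL (NewtonExp.dep n) ((List.range n).map fun i =>
      absLeL (NewtonExp.dep n) (xvL i) (addL (νL n) (lNeg :: mulL (natL 2) (mulL (mulL (natL n) (βL n)) (δL n))))),
    leL (NewtonExp.dep n) (mulL (mulL (mulL (natL 4) (lipL n F)) (mulL (natL n) (βL n)))
      (mulL (mulL (natL n) (βL n)) (δL n))) [lOne] ]
/-- letters of `F_i(x̄)` at depth `dep n + n` [folklore] -/
def FxL (i : ℕ) : List ℕ := (evalL n xvL (F.getD i [])).map (relabL fun j => NewtonExp.dep n + j)
/-- letters of `zeroB` [folklore] -/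
def zeroNL : List ℕ :=
  andLL (NewtonExp.dep n + n) ((List.range n).map fun i => eqL (NewtonExp.dep n + n) (FxL n F i) [lZero])
/-- letters of `exN k φ` at base depth `d` [folklore] -/
def exNL (d : ℕ) : ℕ → List ℕ → List ℕ
  | 0, l => l
  | k + 1, l => exNL d k (3 :: 7 :: 3 :: (l ++ [4 * (d + k + 1) + 11, 4 * (d + k) + 11]))
/-- **letters of the code Newton sentence** [folklore] -/
def codeNewtonL : List ℕ :=
  List.replicate (NewtonExp.dep n) 7 ++ impL (hypL n F) (exNL (NewtonExp.dep n) n (zeroNL n F))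

/-! #### Correctness of the letters -/

/-- The letters of `qv`. [folklore] -/
theorem termLetters_qv (i : Fin n) : termLetters (qv n i) = xvL i.val := by
  rw [qv, termLetters_var]; rfl

/-- The letters of `bv`. [folklore] -/
theorem termLetters_bv' (i j : Fin n) : termLetters (NewtonExp.bv n i j) = bvL n i.val j.val := by
  rw [NewtonExp.bv, termLetters_var]
  simp [bvL, NewtonExp.bIdx]

/-- The letters of `βv`. [folklore] -/
theorem termLetters_βv : termLetters (βv n) = βL n := by
  rw [βv, termLetters_var]; simp [βL, NewtonExp.cIdx]
/-- The letters of `δv`. [folklore] -/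
theorem termLetters_δv : termLetters (δv n) = δL n := by
  rw [δv, termLetters_var]; simp [δL, NewtonExp.cIdx]
/-- The letters of `νv`. [folklore] -/
theorem termLetters_νv : termLetters (νv n) = νL n := by
  rw [νv, termLetters_var]; simp [νL, NewtonExp.cIdx]

/-- Relabelling along `qIdx` does not change the letters. [folklore] -/
theorem termLetters_relabel_qIdx (t : Language.orderedExpRing.Term (Empty ⊕ Fin n)) :
    termLetters (t.relabel (Sum.map _root_.id (qIdx n))) = termLetters t := by
  rw [termLetters_relabel (qIdx n) _root_.id (fun i => rfl) t]
  conv_rhs => rw [← List.map_id (termLetters t)]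
  exact List.map_congr_left fun l _ => relabL_id l

/-- The letters of `FqB`. [folklore] -/
theorem termLetters_FqB (i : Fin n) :
    termLetters (FqB (fun i => rowTerm n F i) i) = FqL n F i.val := by
  rw [FqB, termLetters_relabel_qIdx, rowTerm, FqL,
    termLetters_evalTermX n (fun j => var (Sum.inr j)) xvL (fun j => termLetters_var j)]

/-- The letters of `GqB`. [folklore] -/
theorem termLetters_GqB (j k : Fin n) :
    termLetters (GqB (pdRowTerm n F) j k) = GqL n F j.val k.val := by
  rw [GqB, termLetters_relabel_qIdx, pdRowTerm, GqL,
    termLetters_evalTermX n (fun j => var (Sum.inr j)) xvL (fun j => termLetters_var j)]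

/-- The letters of the majorised second-derivative terms. [folklore] -/
theorem termLetters_majTerm_pd2RowTerm (i j k : Fin n) :
    termLetters (majTerm (νv n) (pd2RowTerm n F i j k)) = majL (νL n) (HL n F i.val j.val k.val) := by
  rw [termLetters_majTerm, termLetters_νv, pd2RowTerm, HL,
    termLetters_evalTermX n (fun j => var (Sum.inr j)) xvL (fun j => termLetters_var j)]

/-- The letters of `lipB`. [folklore] -/
theorem termLetters_lipB : termLetters (lipB (pd2RowTerm n F)) = lipL n F := by
  simp only [lipB, termLetters_sumTerm, List.map_map, Function.comp_def, termLetters_majTerm_pd2RowTerm, lipL]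
  rw [← map_finRange_val n fun i => sumL ((List.range n).map fun j =>
    sumL ((List.range n).map fun k => majL (νL n) (HL n F i j k)))]
  congr 1
  refine List.map_congr_left fun i _ => ?_
  rw [← map_finRange_val n fun j => sumL ((List.range n).map fun k => majL (νL n) (HL n F i.val j k))]
  congr 1
  refine List.map_congr_left fun j _ => ?_
  rw [← map_finRange_val n fun k => majL (νL n) (HL n F i.val j.val k)]

/-- The letters of `absLeB`. [folklore] -/
theorem formulaLetters_absLeB {d : ℕ} (t s : Language.orderedExpRing.Term (Empty ⊕ Fin d)) :
    formulaLetters (absLeB t s) = absLeL d (termLetters t) (termLetters s) := by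
  rw [absLeB, formulaLetters_inf', formulaLetters_le, formulaLetters_le, termLetters_neg', absLeL]

/-- The letters of the Kronecker delta term. [folklore] -/
theorem termLetters_ite_eq {d : ℕ} (i k : Fin n) :
    termLetters ((if i = k then 1 else 0 : Language.orderedExpRing.Term (Empty ⊕ Fin d))) =
      if i.val = k.val then [lOne] else [lZero] := by
  by_cases h : i = k
  · subst h; simp [termLetters_one']
  · have h' : i.val ≠ k.val := fun e => h (Fin.ext e)
    simp [h, h', termLetters_zero']

/-- letters of the block `B · G(q̄) = 1` [folklore] -/
def unitBlockL : List ℕ :=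
  andLL (NewtonExp.dep n) ((List.range n).map fun i => andLL (NewtonExp.dep n) ((List.range n).map fun k =>
    eqL (NewtonExp.dep n) (sumL ((List.range n).map fun j => mulL (bvL n i j) (GqL n F j k)))
      (if i = k then [lOne] else [lZero])))

/-- The letters of the block `B · G(q̄) = 1`. [folklore] -/
theorem formulaLetters_unitBlock :
    formulaLetters (andL ((List.finRange n).map fun i => andL ((List.finRange n).map fun k =>
      Term.bdEqual (sumTerm ((List.finRange n).map fun j => NewtonExp.bv n i j * GqB (pdRowTerm n F) j k))
        (if i = k then 1 else 0)))) = unitBlockL n F := by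
  rw [formulaLetters_andL, List.map_map, unitBlockL]
  congr 1
  rw [← map_finRange_val n (fun i => andLL (NewtonExp.dep n) ((List.range n).map fun k =>
    eqL (NewtonExp.dep n) (sumL ((List.range n).map fun j => mulL (bvL n i j) (GqL n F j k)))
      (if i = k then [lOne] else [lZero])))]
  refine List.map_congr_left fun i _ => ?_
  rw [Function.comp_apply, formulaLetters_andL, List.map_map]
  congr 1
  rw [← map_finRange_val n (fun k => eqL (NewtonExp.dep n)
    (sumL ((List.range n).map fun j => mulL (bvL n i.val j) (GqL n F j k))) (if i.val = k then [lOne] else [lZero]))]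
  refine List.map_congr_left fun k _ => ?_
  rw [Function.comp_apply, formulaLetters_bdEqual, termLetters_sumTerm, List.map_map, termLetters_ite_eq]
  congr 2
  rw [← map_finRange_val n (fun j => mulL (bvL n i.val j) (GqL n F j k.val))]
  refine List.map_congr_left fun j _ => ?_
  rw [Function.comp_apply, termLetters_mul', termLetters_bv', termLetters_GqB]

/-- letters of the block `|B i j| ≤ β` [folklore] -/
def bBoundBlockL : List ℕ :=
  andLL (NewtonExp.dep n) ((List.range n).map fun i => andLL (NewtonExp.dep n) ((List.range n).map fun j =>
    absLeL (NewtonExp.dep n) (bvL n i j) (βL n)))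

/-- The letters of the block `|B i j| ≤ β`. [folklore] -/
theorem formulaLetters_bBoundBlock :
    formulaLetters (andL ((List.finRange n).map fun i => andL ((List.finRange n).map fun j =>
      absLeB (NewtonExp.bv n i j) (βv n)))) = bBoundBlockL n := by
  rw [formulaLetters_andL, List.map_map, bBoundBlockL]
  congr 1
  rw [← map_finRange_val n (fun i => andLL (NewtonExp.dep n) ((List.range n).map fun j =>
    absLeL (NewtonExp.dep n) (bvL n i j) (βL n)))]
  refine List.map_congr_left fun i _ => ?_
  rw [Function.comp_apply, formulaLetters_andL, List.map_map]
  congr 1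
  rw [← map_finRange_val n (fun j => absLeL (NewtonExp.dep n) (bvL n i.val j) (βL n))]
  refine List.map_congr_left fun j _ => ?_
  rw [Function.comp_apply, formulaLetters_absLeB, termLetters_bv', termLetters_βv]

/-- letters of the block `|F_i(q̄)| ≤ δ` [folklore] -/
def fBoundBlockL : List ℕ :=
  andLL (NewtonExp.dep n) ((List.range n).map fun i => absLeL (NewtonExp.dep n) (FqL n F i) (δL n))

/-- The letters of the block `|F_i(q̄)| ≤ δ`. [folklore] -/
theorem formulaLetters_fBoundBlock :
    formulaLetters (andL ((List.finRange n).map fun i => absLeB (FqB (fun i => rowTerm n F i) i) (δv n))) =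
      fBoundBlockL n F := by
  rw [formulaLetters_andL, List.map_map, fBoundBlockL]
  congr 1
  rw [← map_finRange_val n (fun i => absLeL (NewtonExp.dep n) (FqL n F i) (δL n))]
  refine List.map_congr_left fun i _ => ?_
  rw [Function.comp_apply, formulaLetters_absLeB, termLetters_FqB, termLetters_δv]

/-- letters of the block `|q_i| ≤ ν − 2 n β δ` [folklore] -/
def qBoundBlockL : List ℕ :=
  andLL (NewtonExp.dep n) ((List.range n).map fun i =>
    absLeL (NewtonExp.dep n) (xvL i) (addL (νL n) (lNeg :: mulL (natL 2) (mulL (mulL (natL n) (βL n)) (δL n)))))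

/-- The letters of the block `|q_i| ≤ ν − 2 n β δ`. [folklore] -/
theorem formulaLetters_qBoundBlock :
    formulaLetters (andL ((List.finRange n).map fun i =>
      absLeB (qv n i) (νv n + -(natTerm 2 * (natTerm n * βv n * δv n))))) = qBoundBlockL n := by
  rw [formulaLetters_andL, List.map_map, qBoundBlockL]
  congr 1
  rw [← map_finRange_val n (fun i => absLeL (NewtonExp.dep n) (xvL i)
    (addL (νL n) (lNeg :: mulL (natL 2) (mulL (mulL (natL n) (βL n)) (δL n)))))]
  refine List.map_congr_left fun i _ => ?_
  rw [Function.comp_apply, formulaLetters_absLeB, termLetters_qv, termLetters_add', termLetters_neg',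
    termLetters_mul', termLetters_mul', termLetters_mul', termLetters_natTerm, termLetters_natTerm,
    termLetters_βv, termLetters_δv, termLetters_νv]

/-- The letters of `hypB`. [folklore] -/
theorem formulaLetters_hypB :
    formulaLetters (hypB (fun i => rowTerm n F i) (pdRowTerm n F) (pd2RowTerm n F)) = hypL n F := by
  rw [hypB, formulaLetters_andL]
  simp only [List.map_cons, List.map_nil, formulaLetters_le, termLetters_zero', termLetters_one',
    termLetters_βv, termLetters_δv, termLetters_νv, formulaLetters_unitBlock, formulaLetters_bBoundBlock,
    formulaLetters_fBoundBlock, formulaLetters_qBoundBlock, termLetters_mul', termLetters_natTerm,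
    termLetters_lipB]
  rfl

/-- The letters of `FxB`. [folklore] -/
theorem termLetters_FxB (i : Fin n) :
    termLetters (FxB (fun i => rowTerm n F i) i) = FxL n F i.val := by
  rw [FxB, termLetters_relabel (xIdx (n := n)) (fun j => NewtonExp.dep n + j) (fun j => rfl), rowTerm, FxL,
    termLetters_evalTermX n (fun j => var (Sum.inr j)) xvL (fun j => termLetters_var j)]

/-- The letters of `zeroB`. [folklore] -/
theorem formulaLetters_zeroB' : formulaLetters (NewtonExp.zeroB (fun i => rowTerm n F i)) = zeroNL n F := by
  rw [NewtonExp.zeroB, formulaLetters_andL, zeroNL, List.map_map]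
  congr 1
  rw [← map_finRange_val n (fun i => eqL (NewtonExp.dep n + n) (FxL n F i) [lZero])]
  refine List.map_congr_left fun i _ => ?_
  simp [formulaLetters_bdEqual, termLetters_FxB, termLetters_zero']

/-- The letters of `exN`. [folklore] -/
theorem formulaLetters_exN {d : ℕ} : ∀ (k : ℕ) (φ : Language.orderedExpRing.BoundedFormula Empty (d + k)),
    formulaLetters (exN k φ) = exNL d k (formulaLetters φ)
  | 0, φ => rfl
  | k + 1, φ => by
    rw [exN, formulaLetters_exN k, exNL, formulaLetters_ex]

/-- **The Gödel letters of the code Newton sentence.** [folklore] -/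
theorem formulaLetters_codeNewtonSentence : formulaLetters (codeNewtonSentence n F) = codeNewtonL n F := by
  rw [codeNewtonSentence, newtonSentence, formulaLetters_alls, formulaLetters_imp', formulaLetters_hypB,
    formulaLetters_exN, formulaLetters_zeroB', codeNewtonL]

/-- **The Gödel number of the code Newton sentence** is the code of its letters. [folklore] -/
theorem godelNumber_codeNewtonSentence : (codeNewtonSentence n F).godelNumber = encode (codeNewtonL n F) := by
  rw [godelNumber_eq, formulaLetters_codeNewtonSentence]

end NewtonLetters

/-! ### Primitive recursiveness of the letters -/

section PrimrecLetters

open Primrec in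
/-- `setExp e k v` on triples `(e, k, v)` [folklore] -/
theorem primrec_setExp : Primrec fun p : List ℕ × ℕ × ℕ => setExp p.1 p.2.1 p.2.2 := by
  unfold setExp
  refine Primrec.list_map (Primrec.list_range.comp (Primrec.nat_max.comp (Primrec.list_length.comp Primrec.fst)
    (Primrec.succ.comp (Primrec.fst.comp Primrec.snd)))) ?_
  have h : Primrec fun q : (List ℕ × ℕ × ℕ) × ℕ => if q.2 = q.1.2.1 then q.1.2.2 else q.1.1.getD q.2 0 :=
    Primrec.ite (PrimrecRel.comp Primrec.eq Primrec.snd (Primrec.fst.comp (Primrec.snd.comp Primrec.fst)))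
      (Primrec.snd.comp (Primrec.snd.comp Primrec.fst))
      ((Primrec.list_getD 0).comp (Primrec.fst.comp Primrec.fst) Primrec.snd)
  exact h.to₂

/-- the code of `c · e` (`c ∈ ℤ` by its code `m`, `e ∈ ℕ`) [folklore] -/
def intMulNatCode (m e : ℕ) : ℕ :=
  if m % 2 = 0 then 2 * (m / 2 * e) else if e = 0 then 0 else 2 * ((m / 2 + 1) * e - 1) + 1

/-- `encode (c · e) = intMulNatCode (encode c) e`. [folklore] -/
theorem encode_int_mul_nat (c : ℤ) (e : ℕ) : encode (c * (e : ℤ)) = intMulNatCode (encode c) e := by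
  cases c with
  | ofNat j =>
    rw [encode_int_ofNat, intMulNatCode, if_pos (by omega), show Int.ofNat j * (e : ℤ) = Int.ofNat (j * e) by
      simp only [Int.ofNat_eq_natCast]; push_cast; ring, encode_int_ofNat]
    congr 1
    rw [Nat.mul_div_cancel_left _ (by norm_num)]
  | negSucc j =>
    rw [encode_int_negSucc, intMulNatCode, if_neg (by omega)]
    rcases Nat.eq_zero_or_pos e with rfl | he
    · rw [if_pos rfl, Nat.cast_zero, mul_zero]
      exact encode_int_ofNat 0
    · rw [if_neg he.ne', show (2 * j + 1) / 2 = j by omega]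
      have h1 : 1 ≤ (j + 1) * e := Nat.one_le_iff_ne_zero.2 (Nat.mul_ne_zero (by omega) he.ne')
      have : Int.negSucc j * (e : ℤ) = Int.negSucc ((j + 1) * e - 1) := by
        rw [Int.negSucc_eq, Int.negSucc_eq]
        have : (((j + 1) * e - 1 : ℕ) : ℤ) = ((j + 1) * e : ℕ) - 1 := by
          rw [Nat.cast_sub h1, Nat.cast_one]
        rw [this]
        push_cast
        ring
      rw [this, encode_int_negSucc]

/-- `intMulNatCode` is primitive recursive. [folklore] -/
theorem primrec_intMulNatCode : Primrec₂ intMulNatCode := by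
  unfold intMulNatCode
  have hm : Primrec fun p : ℕ × ℕ => p.1 := Primrec.fst
  have he : Primrec fun p : ℕ × ℕ => p.2 := Primrec.snd
  have hhalf : Primrec fun p : ℕ × ℕ => p.1 / 2 := Primrec.nat_div.comp hm (Primrec.const 2)
  refine (Primrec.ite (PrimrecRel.comp Primrec.eq (Primrec.nat_mod.comp hm (Primrec.const 2)) (Primrec.const 0))
    (Primrec.nat_mul.comp (Primrec.const 2) (Primrec.nat_mul.comp hhalf he))
    (Primrec.ite (PrimrecRel.comp Primrec.eq he (Primrec.const 0)) (Primrec.const 0)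
      (Primrec.succ.comp (Primrec.nat_mul.comp (Primrec.const 2)
        (Primrec.nat_sub.comp (Primrec.nat_mul.comp (Primrec.succ.comp hhalf) he) (Primrec.const 1)))))).to₂

/-- `(c, e) ↦ c · e : ℤ × ℕ → ℤ` is primitive recursive. [folklore] -/
theorem primrec_int_mul_nat : Primrec fun p : ℤ × ℕ => p.1 * (p.2 : ℤ) :=
  Primrec.encode_iff.1 ((primrec_intMulNatCode.comp (Primrec.encode.comp Primrec.fst) Primrec.snd).of_eq
    fun p => (encode_int_mul_nat p.1 p.2).symm)

/-- `pdMono n k m` on triples `(n, k, m)` [folklore] -/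
theorem primrec_pdMono : Primrec fun p : ℕ × ℕ × (ℤ × List ℕ) => pdMono p.1 p.2.1 p.2.2 := by
  unfold pdMono
  have hn : Primrec fun p : ℕ × ℕ × (ℤ × List ℕ) => p.1 := Primrec.fst
  have hk : Primrec fun p : ℕ × ℕ × (ℤ × List ℕ) => p.2.1 := Primrec.fst.comp Primrec.snd
  have hc : Primrec fun p : ℕ × ℕ × (ℤ × List ℕ) => p.2.2.1 := Primrec.fst.comp (Primrec.snd.comp Primrec.snd)
  have he : Primrec fun p : ℕ × ℕ × (ℤ × List ℕ) => p.2.2.2 := Primrec.snd.comp (Primrec.snd.comp Primrec.snd)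
  have hek : Primrec fun p : ℕ × ℕ × (ℤ × List ℕ) => p.2.2.2.getD p.2.1 0 := (Primrec.list_getD 0).comp he hk
  have henk : Primrec fun p : ℕ × ℕ × (ℤ × List ℕ) => p.2.2.2.getD (p.1 + p.2.1) 0 :=
    (Primrec.list_getD 0).comp he (Primrec.nat_add.comp hn hk)
  refine Primrec.list_cons.comp (Primrec.pair (primrec_int_mul_nat.comp (Primrec.pair hc hek))
    (primrec_setExp.comp (Primrec.pair he (Primrec.pair hk (Primrec.pred.comp hek))))) ?_
  exact Primrec.list_cons.comp (Primrec.pair (primrec_int_mul_nat.comp (Primrec.pair hc henk)) he)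
    (Primrec.const [])

/-- `pdCode` as a `flatMap`. [folklore] -/
theorem pdCode_eq_flatMap (n k : ℕ) : ∀ p : ExpPolyCode, pdCode n k p = p.flatMap (pdMono n k)
  | [] => rfl
  | m :: p => by rw [pdCode, List.flatMap_cons, pdCode_eq_flatMap n k p]

/-- `pdCode n k p` on triples `(n, k, p)` [folklore] -/
theorem primrec_pdCode : Primrec fun p : ℕ × ℕ × ExpPolyCode => pdCode p.1 p.2.1 p.2.2 := by
  have h : Primrec fun p : ℕ × ℕ × ExpPolyCode => p.2.2.flatMap (pdMono p.1 p.2.1) :=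
    Primrec.list_flatMap (Primrec.snd.comp Primrec.snd)
      (primrec_pdMono.comp (Primrec.pair (Primrec.fst.comp Primrec.fst)
        (Primrec.pair (Primrec.fst.comp (Primrec.snd.comp Primrec.fst)) Primrec.snd))).to₂
  exact h.of_eq fun p => (pdCode_eq_flatMap _ _ _).symm

/-- `majL` as a right fold. [folklore] -/
theorem majL_eq_foldr (wL tL : List ℕ) :
    majL wL tL = tL.foldr (fun l acc => (if l = lNeg then [] else if l % 4 = 2 then wL else [l]) ++ acc) [] := by
  induction tL with
  | nil => rfl
  | cons l tL ih => rw [majL_cons, ih, List.foldr_cons]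

/-- `majL` is primitive recursive. [folklore] -/
theorem primrec_majL : Primrec₂ majL := by
  have hstep : Primrec fun q : (List ℕ × List ℕ) × (ℕ × List ℕ) =>
      (if q.2.1 = lNeg then [] else if q.2.1 % 4 = 2 then q.1.1 else [q.2.1]) ++ q.2.2 := by
    refine Primrec.list_append.comp ?_ (Primrec.snd.comp Primrec.snd)
    have hl : Primrec fun q : (List ℕ × List ℕ) × (ℕ × List ℕ) => q.2.1 := Primrec.fst.comp Primrec.snd
    exact Primrec.ite (PrimrecRel.comp Primrec.eq hl (Primrec.const lNeg)) (Primrec.const [])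
      (Primrec.ite (PrimrecRel.comp Primrec.eq (Primrec.nat_mod.comp hl (Primrec.const 4)) (Primrec.const 2))
        (Primrec.fst.comp Primrec.fst) (Primrec.list_cons.comp hl (Primrec.const [])))
  have h : Primrec fun p : List ℕ × List ℕ =>
      p.2.foldr (fun l acc => (if l = lNeg then [] else if l % 4 = 2 then p.1 else [l]) ++ acc) [] :=
    Primrec.list_foldr Primrec.snd (Primrec.const []) hstep.to₂
  exact (h.of_eq fun p => (majL_eq_foldr p.1 p.2).symm).to₂

/-- the depth `dep n = n + n·n + 3` [folklore] -/
theorem primrec_dep : Primrec fun n : ℕ => NewtonExp.dep n :=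
  Primrec.nat_add.comp primrec_depth (Primrec.const 3)

/-- `βL` [folklore] -/
theorem primrec_βL : Primrec βL := by
  unfold βL
  exact Primrec.list_cons.comp (Primrec.nat_add.comp (Primrec.nat_mul.comp (Primrec.const 4) primrec_depth)
    (Primrec.const 2)) (Primrec.const [])
/-- `δL` [folklore] -/
theorem primrec_δL : Primrec δL := by
  unfold δL
  exact Primrec.list_cons.comp (Primrec.nat_add.comp (Primrec.nat_mul.comp (Primrec.const 4)
    (Primrec.succ.comp primrec_depth)) (Primrec.const 2)) (Primrec.const [])
/-- `νL` [folklore] -/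
theorem primrec_νL : Primrec νL := by
  unfold νL
  exact Primrec.list_cons.comp (Primrec.nat_add.comp (Primrec.nat_mul.comp (Primrec.const 4)
    (Primrec.nat_add.comp primrec_depth (Primrec.const 2))) (Primrec.const 2)) (Primrec.const [])

/-- `FqL n F i` on `((n, F), i)` [folklore] -/
theorem primrec_FqL : Primrec fun q : (ℕ × List ExpPolyCode) × ℕ => FqL q.1.1 q.1.2 q.2 := by
  unfold FqL
  exact primrec_evalL.comp (Primrec.pair (Primrec.fst.comp Primrec.fst)
    ((Primrec.list_getD []).comp (Primrec.snd.comp Primrec.fst) Primrec.snd))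

set_option maxHeartbeats 1000000 in
/-- `GqL n F j k` on `(((n, F), j), k)` [folklore] -/
theorem primrec_GqL : Primrec fun q : ((ℕ × List ExpPolyCode) × ℕ) × ℕ => GqL q.1.1.1 q.1.1.2 q.1.2 q.2 := by
  unfold GqL
  refine primrec_evalL.comp (Primrec.pair (Primrec.fst.comp (Primrec.fst.comp Primrec.fst)) ?_)
  exact primrec_pdCode.comp (Primrec.pair (Primrec.fst.comp (Primrec.fst.comp Primrec.fst))
    (Primrec.pair Primrec.snd ((Primrec.list_getD []).comp (Primrec.snd.comp (Primrec.fst.comp Primrec.fst))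
      (Primrec.snd.comp Primrec.fst))))

set_option maxHeartbeats 1000000 in
/-- `HL n F i j k` on `((((n, F), i), j), k)` [folklore] -/
theorem primrec_HL :
    Primrec fun q : (((ℕ × List ExpPolyCode) × ℕ) × ℕ) × ℕ => HL q.1.1.1.1 q.1.1.1.2 q.1.1.2 q.1.2 q.2 := by
  unfold HL
  have hn : Primrec fun q : (((ℕ × List ExpPolyCode) × ℕ) × ℕ) × ℕ => q.1.1.1.1 :=
    Primrec.fst.comp (Primrec.fst.comp (Primrec.fst.comp Primrec.fst))
  have hF : Primrec fun q : (((ℕ × List ExpPolyCode) × ℕ) × ℕ) × ℕ => q.1.1.1.2 :=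
    Primrec.snd.comp (Primrec.fst.comp (Primrec.fst.comp Primrec.fst))
  have hi : Primrec fun q : (((ℕ × List ExpPolyCode) × ℕ) × ℕ) × ℕ => q.1.1.2 :=
    Primrec.snd.comp (Primrec.fst.comp Primrec.fst)
  have hj : Primrec fun q : (((ℕ × List ExpPolyCode) × ℕ) × ℕ) × ℕ => q.1.2 := Primrec.snd.comp Primrec.fst
  refine primrec_evalL.comp (Primrec.pair hn ?_)
  refine primrec_pdCode.comp (Primrec.pair hn (Primrec.pair Primrec.snd ?_))
  exact primrec_pdCode.comp (Primrec.pair hn (Primrec.pair hj ((Primrec.list_getD []).comp hF hi)))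

set_option maxHeartbeats 1000000 in
/-- `lipL n F` on pairs `(n, F)` [folklore] -/
theorem primrec_lipL : Primrec fun p : ℕ × List ExpPolyCode => lipL p.1 p.2 := by
  unfold lipL
  refine primrec_sumL.comp (Primrec.list_map (Primrec.list_range.comp Primrec.fst) ?_)
  have h1 : Primrec fun q : (ℕ × List ExpPolyCode) × ℕ => sumL ((List.range q.1.1).map fun j =>
      sumL ((List.range q.1.1).map fun k => majL (νL q.1.1) (HL q.1.1 q.1.2 q.2 j k))) := by
    refine primrec_sumL.comp (Primrec.list_map (Primrec.list_range.comp (Primrec.fst.comp Primrec.fst)) ?_)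
    have h2 : Primrec fun r : ((ℕ × List ExpPolyCode) × ℕ) × ℕ =>
        sumL ((List.range r.1.1.1).map fun k => majL (νL r.1.1.1) (HL r.1.1.1 r.1.1.2 r.1.2 r.2 k)) := by
      refine primrec_sumL.comp (Primrec.list_map
        (Primrec.list_range.comp (Primrec.fst.comp (Primrec.fst.comp Primrec.fst))) ?_)
      have h3 : Primrec fun s : (((ℕ × List ExpPolyCode) × ℕ) × ℕ) × ℕ =>
          majL (νL s.1.1.1.1) (HL s.1.1.1.1 s.1.1.1.2 s.1.1.2 s.1.2 s.2) :=
        primrec_majL.comp (primrec_νL.comp (Primrec.fst.comp (Primrec.fst.comp (Primrec.fst.comp Primrec.fst))))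
          primrec_HL
      exact h3.to₂
    exact h2.to₂
  exact h1.to₂

/-- `absLeL d tL sL` on triples [folklore] -/
theorem primrec_absLeL : Primrec fun p : ℕ × List ℕ × List ℕ => absLeL p.1 p.2.1 p.2.2 := by
  unfold absLeL
  have hd : Primrec fun p : ℕ × List ℕ × List ℕ => p.1 := Primrec.fst
  have ht : Primrec fun p : ℕ × List ℕ × List ℕ => p.2.1 := Primrec.fst.comp Primrec.snd
  have hs : Primrec fun p : ℕ × List ℕ × List ℕ => p.2.2 := Primrec.snd.comp Primrec.snd
  exact primrec_infL.comp (Primrec.pair hd (Primrec.pair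
    (primrec_leL.comp (Primrec.pair hd (Primrec.pair (Primrec.list_cons.comp (Primrec.const lNeg) hs) ht)))
    (primrec_leL.comp (Primrec.pair hd (Primrec.pair ht hs)))))

set_option maxHeartbeats 1000000 in
/-- `unitBlockL n F` on pairs [folklore] -/
theorem primrec_unitBlockL : Primrec fun p : ℕ × List ExpPolyCode => unitBlockL p.1 p.2 := by
  unfold unitBlockL
  refine primrec_andLL.comp (primrec_dep.comp Primrec.fst) (Primrec.list_map (Primrec.list_range.comp Primrec.fst) ?_)
  have h1 : Primrec fun q : (ℕ × List ExpPolyCode) × ℕ => andLL (NewtonExp.dep q.1.1) ((List.range q.1.1).map fun k =>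
      eqL (NewtonExp.dep q.1.1) (sumL ((List.range q.1.1).map fun j => mulL (bvL q.1.1 q.2 j) (GqL q.1.1 q.1.2 j k)))
        (if q.2 = k then [lOne] else [lZero])) := by
    refine primrec_andLL.comp (primrec_dep.comp (Primrec.fst.comp Primrec.fst))
      (Primrec.list_map (Primrec.list_range.comp (Primrec.fst.comp Primrec.fst)) ?_)
    have h2 : Primrec fun r : ((ℕ × List ExpPolyCode) × ℕ) × ℕ =>
        eqL (NewtonExp.dep r.1.1.1) (sumL ((List.range r.1.1.1).map fun j =>
          mulL (bvL r.1.1.1 r.1.2 j) (GqL r.1.1.1 r.1.1.2 j r.2))) (if r.1.2 = r.2 then [lOne] else [lZero]) := by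
      have hn : Primrec fun r : ((ℕ × List ExpPolyCode) × ℕ) × ℕ => r.1.1.1 := Primrec.fst.comp (Primrec.fst.comp Primrec.fst)
      refine primrec_eqL.comp (Primrec.pair (primrec_dep.comp hn) (Primrec.pair ?_ ?_))
      · refine primrec_sumL.comp (Primrec.list_map (Primrec.list_range.comp hn) ?_)
        have h3 : Primrec fun s : (((ℕ × List ExpPolyCode) × ℕ) × ℕ) × ℕ =>
            mulL (bvL s.1.1.1.1 s.1.1.2 s.2) (GqL s.1.1.1.1 s.1.1.1.2 s.2 s.1.2) := by
          refine primrec_mulL.comp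
            (primrec_bvL.comp (Primrec.pair (Primrec.fst.comp (Primrec.fst.comp (Primrec.fst.comp Primrec.fst)))
              (Primrec.pair (Primrec.snd.comp (Primrec.fst.comp Primrec.fst)) Primrec.snd))) ?_
          exact primrec_GqL.comp (Primrec.pair (Primrec.pair (Primrec.fst.comp (Primrec.fst.comp Primrec.fst))
            Primrec.snd) (Primrec.snd.comp Primrec.fst))
        exact h3.to₂
      · exact Primrec.ite (PrimrecRel.comp Primrec.eq (Primrec.snd.comp Primrec.fst) Primrec.snd)
          (Primrec.const _) (Primrec.const _)
    exact h2.to₂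
  exact h1.to₂

set_option maxHeartbeats 1000000 in
/-- `bBoundBlockL n` [folklore] -/
theorem primrec_bBoundBlockL : Primrec bBoundBlockL := by
  unfold bBoundBlockL
  refine primrec_andLL.comp primrec_dep (Primrec.list_map Primrec.list_range ?_)
  have h1 : Primrec fun q : ℕ × ℕ => andLL (NewtonExp.dep q.1) ((List.range q.1).map fun j =>
      absLeL (NewtonExp.dep q.1) (bvL q.1 q.2 j) (βL q.1)) := by
    refine primrec_andLL.comp (primrec_dep.comp Primrec.fst) (Primrec.list_map (Primrec.list_range.comp Primrec.fst) ?_)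
    have h2 : Primrec fun r : (ℕ × ℕ) × ℕ => absLeL (NewtonExp.dep r.1.1) (bvL r.1.1 r.1.2 r.2) (βL r.1.1) :=
      primrec_absLeL.comp (Primrec.pair (primrec_dep.comp (Primrec.fst.comp Primrec.fst)) (Primrec.pair
        (primrec_bvL.comp (Primrec.pair (Primrec.fst.comp Primrec.fst) (Primrec.pair (Primrec.snd.comp Primrec.fst)
          Primrec.snd))) (primrec_βL.comp (Primrec.fst.comp Primrec.fst))))
    exact h2.to₂
  exact h1.to₂

set_option maxHeartbeats 1000000 in
/-- `fBoundBlockL n F` on pairs [folklore] -/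
theorem primrec_fBoundBlockL : Primrec fun p : ℕ × List ExpPolyCode => fBoundBlockL p.1 p.2 := by
  unfold fBoundBlockL
  refine primrec_andLL.comp (primrec_dep.comp Primrec.fst) (Primrec.list_map (Primrec.list_range.comp Primrec.fst) ?_)
  have h1 : Primrec fun q : (ℕ × List ExpPolyCode) × ℕ =>
      absLeL (NewtonExp.dep q.1.1) (FqL q.1.1 q.1.2 q.2) (δL q.1.1) :=
    primrec_absLeL.comp (Primrec.pair (primrec_dep.comp (Primrec.fst.comp Primrec.fst)) (Primrec.pair primrec_FqL
      (primrec_δL.comp (Primrec.fst.comp Primrec.fst))))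
  exact h1.to₂

/-- `qBoundBlockL n` [folklore] -/
theorem primrec_qBoundBlockL : Primrec qBoundBlockL := by
  unfold qBoundBlockL
  refine primrec_andLL.comp primrec_dep (Primrec.list_map Primrec.list_range ?_)
  have h1 : Primrec fun q : ℕ × ℕ => absLeL (NewtonExp.dep q.1) (xvL q.2)
      (addL (νL q.1) (lNeg :: mulL (natL 2) (mulL (mulL (natL q.1) (βL q.1)) (δL q.1)))) := by
    refine primrec_absLeL.comp (Primrec.pair (primrec_dep.comp Primrec.fst) (Primrec.pair
      (primrec_xvL.comp Primrec.snd) ?_))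
    refine primrec_addL.comp (primrec_νL.comp Primrec.fst) (Primrec.list_cons.comp (Primrec.const lNeg) ?_)
    refine primrec_mulL.comp (Primrec.const (natL 2)) ?_
    exact primrec_mulL.comp (primrec_mulL.comp (primrec_natL.comp Primrec.fst) (primrec_βL.comp Primrec.fst))
      (primrec_δL.comp Primrec.fst)
  exact h1.to₂

set_option maxHeartbeats 1000000 in
/-- `hypL n F` on pairs [folklore] -/
theorem primrec_hypL : Primrec fun p : ℕ × List ExpPolyCode => hypL p.1 p.2 := by
  have hn : Primrec fun p : ℕ × List ExpPolyCode => p.1 := Primrec.fst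
  have hd : Primrec fun p : ℕ × List ExpPolyCode => NewtonExp.dep p.1 := primrec_dep.comp hn
  have hβ : Primrec fun p : ℕ × List ExpPolyCode => βL p.1 := primrec_βL.comp hn
  have hδ : Primrec fun p : ℕ × List ExpPolyCode => δL p.1 := primrec_δL.comp hn
  have hν : Primrec fun p : ℕ × List ExpPolyCode => νL p.1 := primrec_νL.comp hn
  have hnβ : Primrec fun p : ℕ × List ExpPolyCode => mulL (natL p.1) (βL p.1) :=
    primrec_mulL.comp (primrec_natL.comp hn) hβ
  have hlast : Primrec fun p : ℕ × List ExpPolyCode =>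
      leL (NewtonExp.dep p.1) (mulL (mulL (mulL (natL 4) (lipL p.1 p.2)) (mulL (natL p.1) (βL p.1)))
        (mulL (mulL (natL p.1) (βL p.1)) (δL p.1))) [lOne] :=
    primrec_leL.comp (Primrec.pair hd (Primrec.pair
      (primrec_mulL.comp (primrec_mulL.comp (primrec_mulL.comp (Primrec.const (natL 4)) primrec_lipL) hnβ)
        (primrec_mulL.comp hnβ hδ)) (Primrec.const [lOne])))
  have h : Primrec fun p : ℕ × List ExpPolyCode =>
      andLL (NewtonExp.dep p.1) [
        leL (NewtonExp.dep p.1) [lZero] (βL p.1),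
        leL (NewtonExp.dep p.1) [lZero] (δL p.1),
        leL (NewtonExp.dep p.1) [lZero] (νL p.1),
        unitBlockL p.1 p.2, bBoundBlockL p.1, fBoundBlockL p.1 p.2, qBoundBlockL p.1,
        leL (NewtonExp.dep p.1) (mulL (mulL (mulL (natL 4) (lipL p.1 p.2)) (mulL (natL p.1) (βL p.1)))
          (mulL (mulL (natL p.1) (βL p.1)) (δL p.1))) [lOne] ] := by
    refine primrec_andLL.comp hd ?_
    refine Primrec.list_cons.comp (primrec_leL.comp (Primrec.pair hd (Primrec.pair (Primrec.const _) hβ))) ?_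
    refine Primrec.list_cons.comp (primrec_leL.comp (Primrec.pair hd (Primrec.pair (Primrec.const _) hδ))) ?_
    refine Primrec.list_cons.comp (primrec_leL.comp (Primrec.pair hd (Primrec.pair (Primrec.const _) hν))) ?_
    refine Primrec.list_cons.comp primrec_unitBlockL ?_
    refine Primrec.list_cons.comp (primrec_bBoundBlockL.comp hn) ?_
    refine Primrec.list_cons.comp primrec_fBoundBlockL ?_
    refine Primrec.list_cons.comp (primrec_qBoundBlockL.comp hn) ?_
    exact Primrec.list_cons.comp hlast (Primrec.const [])
  exact h.of_eq fun p => rfl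

/-- the shift of variable letters by `d` [folklore] -/
theorem primrec_relabL_add : Primrec fun p : ℕ × ℕ => relabL (fun j => p.1 + j) p.2 := by
  unfold relabL
  exact Primrec.ite (PrimrecRel.comp Primrec.eq (Primrec.nat_mod.comp Primrec.snd (Primrec.const 4)) (Primrec.const 2))
    (Primrec.nat_add.comp (Primrec.nat_mul.comp (Primrec.const 4) (Primrec.nat_add.comp Primrec.fst
      (Primrec.nat_div.comp Primrec.snd (Primrec.const 4)))) (Primrec.const 2)) Primrec.snd

/-- `FxL n F i` on `((n, F), i)` [folklore] -/
theorem primrec_FxL : Primrec fun q : (ℕ × List ExpPolyCode) × ℕ => FxL q.1.1 q.1.2 q.2 := by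
  unfold FxL
  refine Primrec.list_map primrec_FqL ?_
  exact (primrec_relabL_add.comp (Primrec.pair (primrec_dep.comp (Primrec.fst.comp (Primrec.fst.comp Primrec.fst)))
    Primrec.snd)).to₂

set_option maxHeartbeats 1000000 in
/-- `zeroNL n F` on pairs [folklore] -/
theorem primrec_zeroNL : Primrec fun p : ℕ × List ExpPolyCode => zeroNL p.1 p.2 := by
  unfold zeroNL
  have hdn : Primrec fun p : ℕ × List ExpPolyCode => NewtonExp.dep p.1 + p.1 :=
    Primrec.nat_add.comp (primrec_dep.comp Primrec.fst) Primrec.fst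
  refine primrec_andLL.comp hdn (Primrec.list_map (Primrec.list_range.comp Primrec.fst) ?_)
  have h1 : Primrec fun q : (ℕ × List ExpPolyCode) × ℕ => eqL (NewtonExp.dep q.1.1 + q.1.1) (FxL q.1.1 q.1.2 q.2) [lZero] :=
    primrec_eqL.comp (Primrec.pair (hdn.comp Primrec.fst) (Primrec.pair primrec_FxL (Primrec.const _)))
  exact h1.to₂

/-- `exNL` as a right fold over `range k`. [folklore] -/
theorem exNL_eq_foldr (d : ℕ) : ∀ (k : ℕ) (l : List ℕ),
    exNL d k l = (List.range k).foldr (fun i acc => 3 :: 7 :: 3 :: (acc ++ [4 * (d + i + 1) + 11, 4 * (d + i) + 11])) l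
  | 0, l => rfl
  | k + 1, l => by
    rw [exNL, exNL_eq_foldr d k, List.range_succ, List.foldr_append]
    rfl

set_option maxHeartbeats 1000000 in
/-- `exNL d k l` on triples [folklore] -/
theorem primrec_exNL : Primrec fun p : ℕ × ℕ × List ℕ => exNL p.1 p.2.1 p.2.2 := by
  have hstep : Primrec fun q : (ℕ × ℕ × List ℕ) × (ℕ × List ℕ) =>
      3 :: 7 :: 3 :: (q.2.2 ++ [4 * (q.1.1 + q.2.1 + 1) + 11, 4 * (q.1.1 + q.2.1) + 11]) := by
    have hd : Primrec fun q : (ℕ × ℕ × List ℕ) × (ℕ × List ℕ) => q.1.1 := Primrec.fst.comp Primrec.fst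
    have hi : Primrec fun q : (ℕ × ℕ × List ℕ) × (ℕ × List ℕ) => q.2.1 := Primrec.fst.comp Primrec.snd
    have hdi : Primrec fun q : (ℕ × ℕ × List ℕ) × (ℕ × List ℕ) => q.1.1 + q.2.1 := Primrec.nat_add.comp hd hi
    refine Primrec.list_cons.comp (Primrec.const 3) (Primrec.list_cons.comp (Primrec.const 7)
      (Primrec.list_cons.comp (Primrec.const 3) (Primrec.list_append.comp (Primrec.snd.comp Primrec.snd) ?_)))
    refine Primrec.list_cons.comp (Primrec.nat_add.comp (Primrec.nat_mul.comp (Primrec.const 4)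
      (Primrec.succ.comp hdi)) (Primrec.const 11)) ?_
    exact Primrec.list_cons.comp (Primrec.nat_add.comp (Primrec.nat_mul.comp (Primrec.const 4) hdi) (Primrec.const 11))
      (Primrec.const [])
  have h : Primrec fun p : ℕ × ℕ × List ℕ => (List.range p.2.1).foldr
      (fun i acc => 3 :: 7 :: 3 :: (acc ++ [4 * (p.1 + i + 1) + 11, 4 * (p.1 + i) + 11])) p.2.2 :=
    Primrec.list_foldr (Primrec.list_range.comp (Primrec.fst.comp Primrec.snd)) (Primrec.snd.comp Primrec.snd) hstep.to₂
  exact h.of_eq fun p => (exNL_eq_foldr p.1 p.2.1 p.2.2).symm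

set_option maxHeartbeats 1000000 in
/-- **The letters of the code Newton sentence are a primitive recursive function of `(n, F)`.** [folklore] -/
theorem primrec_codeNewtonL : Primrec fun p : ℕ × List ExpPolyCode => codeNewtonL p.1 p.2 := by
  unfold codeNewtonL
  refine Primrec.list_append.comp ?_ (primrec_impL.comp primrec_hypL (primrec_exNL.comp
    (Primrec.pair (primrec_dep.comp Primrec.fst) (Primrec.pair Primrec.fst primrec_zeroNL))))
  have h : Primrec fun p : ℕ × List ExpPolyCode => (fun l => 7 :: l)^[NewtonExp.dep p.1] ([] : List ℕ) :=
    Primrec.nat_iterate (primrec_dep.comp Primrec.fst) (Primrec.const [])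
      (Primrec.list_cons.comp (Primrec.const 7) Primrec.snd).to₂
  exact h.of_eq fun p => (replicate_eq_iterate _ 7).symm

/-- **The Gödel number of the code Newton sentence is a computable function of `(n, F)`.** [folklore] -/
theorem computable_godelNumber_codeNewtonSentence :
    Computable fun p : ℕ × List ExpPolyCode => (codeNewtonSentence p.1 p.2).godelNumber :=
  ((Primrec.encode.comp primrec_codeNewtonL).to_comp).of_eq fun p => (godelNumber_codeNewtonSentence p.1 p.2).symm

end PrimrecLetters

/-! ### The scheme is recursively enumerable -/

section RE

/-- **The range of a computable function into `ℕ` is r.e.** (semi-decide `k` by searching for a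
code `m` with `f (decode m) = k`). [folklore] -/
theorem _root_.REPred.range_of_computable {α : Type*} [Primcodable α] {f : α → ℕ} (hf : Computable f) :
    REPred fun k => ∃ a, f a = k := by
  classical
  have htest : Computable₂ fun (k m : ℕ) => decide ((decode (α := α) m).map f = some k) := by
    have h1 : Computable fun p : ℕ × ℕ => (decode (α := α) p.2).map f :=
      Computable.option_map (Computable.decode.comp Computable.snd) (hf.comp Computable.snd).to₂
    have h2 : Computable fun p : ℕ × ℕ => (some p.1 : Option ℕ) := Computable.option_some.comp Computable.fst
    exact ((Primrec.eq.decide (α := Option ℕ)).to_comp.comp h1 h2).to₂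
  have hfind : Partrec fun k => Nat.rfind fun m => Part.some (decide ((decode (α := α) m).map f = some k)) :=
    Partrec.rfind htest.partrec₂
  refine (Partrec.dom_re hfind).of_eq fun k => ?_
  rw [Nat.rfind_dom]
  simp only [Part.mem_some_iff, Part.some_dom, implies_true, and_true]
  constructor
  · rintro ⟨m, hm⟩
    cases h : decode (α := α) m with
    | none => rw [h] at hm; exact absurd hm (by simp)
    | some a => rw [h] at hm; exact ⟨a, by simpa using hm⟩
  · rintro ⟨a, rfl⟩
    exact ⟨encode a, by simp⟩

/-- **The scheme of code Newton sentences is an r.e. set of sentences** (leaf (B4) of the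
decomposition of the conditional half of Macintyre–Wilkie's theorem). [folklore] -/
theorem newtonScheme_isREAxioms : newtonScheme.IsREAxioms := by
  refine (REPred.range_of_computable computable_godelNumber_codeNewtonSentence).of_eq fun k => ⟨?_, ?_⟩
  · rintro ⟨p, hp⟩
    exact ⟨_, codeNewtonSentence_mem_newtonScheme p.1 p.2, hp⟩
  · rintro ⟨φ, ⟨n, F, rfl⟩, hk⟩
    exact ⟨(n, F), hk⟩

end RE

end ExpPolyCode

end Literature.ModelTheory.ExponentialFields

end
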